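import Summits.CriticalPhenomena.PercolationContinuityZ3.Theorems.PercNearOneGluingNoHeavyQuantFarBlockTransfer
import HarnessLib

/-!
# QUANT lane R8, front "FAR beyond trees", layer one — ENVIRONMENT-AWARE block transfer II: the OUTSIDE-CUT certificate
# (the cut hypothesis of an outside relay, through Harris' inequality, bounds `1 − t` by `(A₀ + B)/g`)

builds on p205010 (kernel theorem, internal audit signed; external expert review pending)

Support file (`--supports stmt-CriticalPhenomena-4575`), seat `prim-quant-p1` (gen 23); memo
`run/shared/lean/prim/quant/prim-quant-p1-g23/FOR-LEAD-CORESTEP.md` §6.  Standard axioms; no sorries; no definitions.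

Setting of `Block.real_card_le_one_le_of_dominates` (p1 g19): block `Z` at the cut vertex `c`, observer `o ∉ Z`, `P_w(N ≥ 2) = A₀ + B·h_S + C·t_S`
(`Block.real_two_le_card_eq`) with `A₀ = P(#out ≥ 2)`, `B = P(#out = 1 ∧ o ↔ c off Z)`, `C = P(#out = 0 ∧ o ↔ c off Z)`, `g = P(o ↔ c off Z)`.
p1 g19's transfer uses the cut of a BLOCK relay (`1 − t ≤ g τ₀`).  After the `K₂,₃` refutation of environment-agnostic block-locality
(`…QuantFarCoreBlockLocalityFalse`, this seat) the environments that defeat the exit/comparison certificates are those in which the observer reaches `c`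
essentially only when NO outside relay is reached; there the cut hypothesis of an OUTSIDE relay is strong:
* `Block.real_outCount_inter_ge` — Harris: `P(#out ≥ 1) · g ≤ P(#out ≥ 1 ∧ o ↔ c off Z) ≤ A₀ + B`;
* **`Block.real_card_le_one_le_of_outsideExit`** — if some outside relay `a' ∈ A ∖ Z` has `P(o ↮ a') ≤ t`, `g > 0`, and
  `A₀ + B ≤ g·(A₀ + B·h_S + C·t_S)`, then `P_w(N ≤ 1) ≤ t` (certificate: `1 − t ≤ P(o ↔ a') ≤ P(#out ≥ 1) ≤ (A₀ + B)/g`).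
Together with `Block.real_card_le_one_le_of_envExit` (`C(τ₀ − t_S) ≤ A₀(1−τ₀) + B(h_S − τ₀)`, file `…QuantFarBlockEnvExit`) this covers, for a block with
`t_S` slightly below `τ₀`, every environment with `g ≥ (τ₀ − t_S)/((h_S − τ₀)·t_S)`: if the env-exit fails then `A₀ + B < C(τ₀ − t_S)/(h_S − τ₀)` and the
outside-cut certificate needs only `C(τ₀ − t_S)/(h_S − τ₀) ≤ g·C·t_S` (memo §6; for the `K₂,₃` windows the threshold is `g ≥ 0.04`).
[cite: Grimmett1999, Thm. (2.4) p. 34] (Harris); the theorems [this work].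
-/

noncomputable section

namespace Summit.CriticalPhenomena.PercolationContinuityZ3.Theorems

namespace Quant

namespace Block

open Finset MeasureTheory Set
open Literature.Probability.LatticeModels
open Literature.Probability.Percolation
open Bundle (offZ avoid offZ_subset reachable_of_offZ)
open scoped Classical

variable {n : ℕ} {o c : Fin n} {Z : Finset (Fin n)}

/-- `offZ Z` is monotone in the configuration. [this work] -/
theorem offZ_mono (Z : Finset (Fin n)) {ω ω' : BondConfig (Fin n)} (h : ω ≤ ω') : offZ Z ω ≤ offZ Z ω' :=
  fun _ he => ⟨h he.1, he.2⟩

/-- `{ω | offZ Z ω ∈ openConn x y}` is an increasing event. [this work] -/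
theorem isUpperSet_offZ_openConn (Z : Finset (Fin n)) (x y : Fin n) :
    IsUpperSet {ω : BondConfig (Fin n) | offZ Z ω ∈ openConn x y} :=
  fun _ _ hle h => isUpperSet_openConn x y (offZ_mono Z hle) h

/-- "at least `k` outside relays reached off `Z`" is an increasing event. [this work] -/
theorem isUpperSet_outCount (Z B : Finset (Fin n)) (o : Fin n) (k : ℕ) :
    IsUpperSet {ω : BondConfig (Fin n) | k ≤ (B.filter fun a => offZ Z ω ∈ openConn o a).card} := by
  intro ω ω' hle h
  refine le_trans h (Finset.card_le_card fun a ha => ?_)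
  rw [Finset.mem_filter] at ha ⊢
  exact ⟨ha.1, isUpperSet_openConn o a (offZ_mono Z hle) ha.2⟩

/-- **Harris for the environment coefficients**: `P(#out ≥ 1)·g ≤ P(#out ≥ 1 ∧ o ↔ c off Z) ≤ A₀ + B`. [this work] -/
theorem real_outCount_inter_ge (w : Sym2 (Fin n) → unitInterval) (B : Finset (Fin n)) :
    (prodBernoulli w).real {ω | 1 ≤ (B.filter fun a => offZ Z ω ∈ openConn o a).card} * (prodBernoulli w).real {ω | offZ Z ω ∈ openConn o c} ≤
      (prodBernoulli w).real {ω | 2 ≤ (B.filter fun a => offZ Z ω ∈ openConn o a).card} +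
        (prodBernoulli w).real {ω | (B.filter fun a => offZ Z ω ∈ openConn o a).card = 1 ∧ offZ Z ω ∈ openConn o c} := by
  have hmeas : ∀ U : Set (BondConfig (Fin n)), MeasurableSet U := fun U => (Set.toFinite U).measurableSet
  have hH := prodBernoulli_harris w (isUpperSet_outCount Z B o 1) (isUpperSet_offZ_openConn Z o c) (hmeas _) (hmeas _)
  refine le_trans hH ?_
  refine le_trans (measureReal_mono (fun ω hω => ?_) (measure_ne_top _ _)) (measureReal_union_le _ _)
  simp only [Set.mem_inter_iff, mem_setOf_eq, Set.mem_union] at hω ⊢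
  rcases Nat.lt_or_ge (B.filter fun a => offZ Z ω ∈ openConn o a).card 2 with h2 | h2
  · exact Or.inr ⟨by omega, hω.2⟩
  · exact Or.inl h2

/-- **OUTSIDE-CUT EXIT.**  Block `Z` at `c` (`o, c ∉ Z`, `w` vanishes between `Z` and `(Z ∪ {c})ᶜ`), relays `A`, an OUTSIDE relay `a' ∈ A ∖ Z`
with `P(o ↮ a') ≤ t`, `g = P(o ↔ c off Z) > 0`.  If `A₀ + B ≤ g·(A₀ + B·h_S + C·t_S)` then `P_w(N ≤ 1) ≤ t`. [this work] -/
theorem real_card_le_one_le_of_outsideExit (w : Sym2 (Fin n) → unitInterval) (ho : o ∉ Z) (hc : c ∉ Z)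
    (hw : ∀ x y : Fin n, x ≠ y → x ∈ Z → y ∉ Z → y ≠ c → (w s(x, y) : ℝ) = 0)
    (A : Finset (Fin n)) (t : ℝ) {a' : Fin n} (ha' : a' ∈ A \ Z)
    (hcut : (prodBernoulli w).real (openConn o a')ᶜ ≤ t)
    (hg : 0 < (prodBernoulli w).real {ω | offZ Z ω ∈ openConn o c})
    (henv : (prodBernoulli w).real {ω | 2 ≤ ((A \ Z).filter fun a => offZ Z ω ∈ openConn o a).card} +
        (prodBernoulli w).real {ω | ((A \ Z).filter fun a => offZ Z ω ∈ openConn o a).card = 1 ∧ offZ Z ω ∈ openConn o c} ≤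
      (prodBernoulli w).real {ω | offZ Z ω ∈ openConn o c} *
        ((prodBernoulli w).real {ω | 2 ≤ ((A \ Z).filter fun a => offZ Z ω ∈ openConn o a).card} +
          (prodBernoulli w).real {ω | ((A \ Z).filter fun a => offZ Z ω ∈ openConn o a).card = 1 ∧ offZ Z ω ∈ openConn o c} *
            (prodBernoulli w).real {ω | 1 ≤ ((A ∩ Z).filter fun a => onZ Z ω ∈ openConn c a).card} +
          (prodBernoulli w).real {ω | ((A \ Z).filter fun a => offZ Z ω ∈ openConn o a).card = 0 ∧ offZ Z ω ∈ openConn o c} *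
            (prodBernoulli w).real {ω | 2 ≤ ((A ∩ Z).filter fun a => onZ Z ω ∈ openConn c a).card})) :
    (prodBernoulli w).real {ω : BondConfig (Fin n) | (A.filter fun a => ω ∈ openConn o a).card ≤ 1} ≤ t := by
  set μ := prodBernoulli w with hμ
  have hmeas : ∀ U : Set (BondConfig (Fin n)), MeasurableSet U := fun U => (Set.toFinite U).measurableSet
  set A0 := μ.real {ω | 2 ≤ ((A \ Z).filter fun a => offZ Z ω ∈ openConn o a).card} with hA0
  set B := μ.real {ω | ((A \ Z).filter fun a => offZ Z ω ∈ openConn o a).card = 1 ∧ offZ Z ω ∈ openConn o c} with hB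
  set C := μ.real {ω | ((A \ Z).filter fun a => offZ Z ω ∈ openConn o a).card = 0 ∧ offZ Z ω ∈ openConn o c} with hC
  set hS := μ.real {ω | 1 ≤ ((A ∩ Z).filter fun a => onZ Z ω ∈ openConn c a).card} with hhS
  set tS := μ.real {ω | 2 ≤ ((A ∩ Z).filter fun a => onZ Z ω ∈ openConn c a).card} with htS
  set g := μ.real {ω | offZ Z ω ∈ openConn o c} with hgdef
  set U := μ.real {ω | 1 ≤ ((A \ Z).filter fun a => offZ Z ω ∈ openConn o a).card} with hU
  have hD : μ.real {ω : BondConfig (Fin n) | 2 ≤ (A.filter fun a => ω ∈ openConn o a).card} = A0 + B * hS + C * tS :=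
    real_two_le_card_eq w ho hc hw A
  -- the outside relay: `P(o ↔ a') = P(o ↔ a' off Z) ≤ U`
  have ha'Z : a' ∉ Z := (Finset.mem_sdiff.1 ha').2
  have hoff : μ.real (openConn o a') = μ.real {ω | offZ Z ω ∈ openConn o a'} :=
    real_congr_of_good w hw _ _ fun ω hω => by
      simp only [mem_setOf_eq]
      exact reach_off_iff hω ho ha'Z
  have hU1 : μ.real (openConn o a') ≤ U := by
    rw [hoff]
    refine measureReal_mono (fun ω hω => ?_) (measure_ne_top _ _)
    simp only [mem_setOf_eq] at hω ⊢
    exact Finset.card_pos.2 ⟨a', Finset.mem_filter.2 ⟨ha', hω⟩⟩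
  have hca : μ.real (openConn o a' : Set (BondConfig (Fin n)))ᶜ = 1 - μ.real (openConn o a') := probReal_compl_eq_one_sub (hmeas _)
  have h1t : 1 - t ≤ U := by linarith [hcut, hca, hU1]
  -- Harris: `U g ≤ A0 + B`, and the environment hypothesis
  have hHar : U * g ≤ A0 + B := real_outCount_inter_ge w (A \ Z)
  have hkey : g * (1 - t) ≤ g * (A0 + B * hS + C * tS) := by
    have e1 : g * (1 - t) ≤ U * g := by nlinarith [h1t, hg.le]
    linarith [henv]
  have hge : 1 - t ≤ A0 + B * hS + C * tS := le_of_mul_le_mul_left hkey hg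
  have hc2 : μ.real {ω : BondConfig (Fin n) | (A.filter fun a => ω ∈ openConn o a).card ≤ 1} =
      1 - μ.real {ω : BondConfig (Fin n) | 2 ≤ (A.filter fun a => ω ∈ openConn o a).card} := by
    have : {ω : BondConfig (Fin n) | (A.filter fun a => ω ∈ openConn o a).card ≤ 1} =
        {ω : BondConfig (Fin n) | 2 ≤ (A.filter fun a => ω ∈ openConn o a).card}ᶜ := by
      ext ω; simp only [mem_setOf_eq, Set.mem_compl_iff]; omega
    rw [this, probReal_compl_eq_one_sub (hmeas _)]
  rw [hc2, hD]; linarith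

end Block

end Quant

end Summit.CriticalPhenomena.PercolationContinuityZ3.Theorems
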